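import Summits.ResolutionOfSingularities.ResolutionOfSingularities.Theorems.ValuativeLuAlphaPTorsorDimTwo
import Literature.AlgebraicGeometry.Resolution.ValuationDefect
import Literature.AlgebraicGeometry.Resolution.ValuedFunctionFields
import Literature.AlgebraicGeometry.Resolution.AffineDomainDimension
import Mathlib.RingTheory.Ideal.Height

/-!
# `LuAlphaPTorsor` in base dimension two: the registered special cases as corollaries

Crux `Valuative.LuAlphaPTorsor` (item `stmt-ResolutionOfSingularities-0641`), line
`pfaff-line-log-final-forms`. Lead `…-0641-1` registered three base-dimension-two targets
(defectless extensions, Abhyankar places without separability hypothesis, discrete rank-one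
valuations); with the unconditional base-dimension-`≤ 2` theorem
`luAlphaPTorsor_of_ringKrullDim_le_two` (Mon_ν(2), Giraud 1983 along `ν`) landed, each is the
special case obtained by forgetting its extra hypothesis. Recorded here so that the item's stub
list closes. Plus the clean corollary in the language of function fields:
`luAlphaPTorsor_of_trdeg_le_two` — the crux holds for every function field of transcendence
degree `≤ 2` (surfaces), every ground field of characteristic `p`, every valuation.
-/

set_option linter.dupNamespace false

namespace Summit.ResolutionOfSingularities.ResolutionOfSingularities.Theorems.PfaffLine

open IsLocalRing

/-- **Registered target `luAlphaPTorsor_dimTwo_of_isDefectlessIn`**: base dimension `2` and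
`K₀ = k(A₀)` defectless in `K` ⟹ the crux's conclusion. Special case of
`luAlphaPTorsor_of_ringKrullDim_le_two` (the defectlessness hypothesis is not used). [folklore] -/
theorem luAlphaPTorsor_dimTwo_of_isDefectlessIn : ∀ p : ℕ, p.Prime → ∀ (k K : Type) [Field k] [CharP k p] [Field K] [Algebra k K] (O : ValuationSubring K) (A₀ : Subalgebra k K) (h₀ : A₀.toSubring ≤ O.toSubring) (t : K), A₀.FG → t ^ p ∈ A₀ → IsFractionRing (Algebra.adjoin k (insert t (A₀ : Set K))) K → IsRegularLocalRing (Localization.AtPrime (Ideal.comap (Subring.inclusion h₀) (IsLocalRing.maximalIdeal O))) → ringKrullDim (Localization.AtPrime (Ideal.comap (Subring.inclusion h₀) (IsLocalRing.maximalIdeal O))) = 2 → Literature.AlgebraicGeometry.Resolution.IsDefectlessIn (IntermediateField.adjoin k (A₀ : Set K)) (O.comap (algebraMap (IntermediateField.adjoin k (A₀ : Set K)) K)) K → ∃ (A : Subalgebra k K) (h : A.toSubring ≤ O.toSubring), A₀ ≤ A ∧ t ∈ A ∧ A.FG ∧ IsFractionRing A K ∧ IsRegularLocalRing (Localization.AtPrime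 (Ideal.comap (Subring.inclusion h) (IsLocalRing.maximalIdeal O))) := by
  intro p hp k K _ _ _ _ O A₀ h₀ t hfg htp hfr hreg hdim _
  exact luAlphaPTorsor_of_ringKrullDim_le_two p hp k K O A₀ h₀ t hfg htp hfr hreg hdim.le

/-- **Registered target `luAlphaPTorsor_dimTwo_of_isAbhyankarPlace`**: base dimension `2` along
an Abhyankar place (no separability hypothesis on the residue field extension) ⟹ the crux's
conclusion. Special case of `luAlphaPTorsor_of_ringKrullDim_le_two`. [folklore] -/
theorem luAlphaPTorsor_dimTwo_of_isAbhyankarPlace : ∀ p : ℕ, p.Prime → ∀ (k K : Type) [Field k] [CharP k p] [Field K] [Algebra k K] (O : ValuationSubring K) (A₀ : Subalgebra k K) (h₀ : A₀.toSubring ≤ O.toSubring) (t : K), A₀.FG → t ^ p ∈ A₀ → IsFractionRing (Algebra.adjoin k (insert t (A₀ : Set K))) K → IsRegularLocalRing (Localization.AtPrime (Ideal.comap (Subring.inclusion h₀) (IsLocalRing.maximalIdeal O))) → ringKrullDim (Localization.AtPrime (Ideal.comap (Subring.inclusion h₀) (IsLocalRing.maximalIdeal O))) = 2 → Literature.AlgebraicGeometry.Resolution.IsAbhyankarPlace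 O (algebraMap k K).fieldRange ⊤ → ∃ (A : Subalgebra k K) (h : A.toSubring ≤ O.toSubring), A₀ ≤ A ∧ t ∈ A ∧ A.FG ∧ IsFractionRing A K ∧ IsRegularLocalRing (Localization.AtPrime (Ideal.comap (Subring.inclusion h) (IsLocalRing.maximalIdeal O))) := by
  intro p hp k K _ _ _ _ O A₀ h₀ t hfg htp hfr hreg hdim _
  exact luAlphaPTorsor_of_ringKrullDim_le_two p hp k K O A₀ h₀ t hfg htp hfr hreg hdim.le

/-- **Registered target `luAlphaPTorsor_dimTwo_of_discrete`** (lead -1's E1): base dimension `2`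
along a DISCRETE rank-one valuation (value group generated by the value of one element `π`)
⟹ the crux's conclusion. Special case of `luAlphaPTorsor_of_ringKrullDim_le_two` (the
discreteness hypothesis is not used; the discrete-specific "slack" layers
`…Discrete{FreeRegime,InitialDerivation,DerivationChain,CleanBound,Rounds,Descent}.lean` remain
in the tree as an independent partial route). [folklore] -/
theorem luAlphaPTorsor_dimTwo_of_discrete : ∀ p : ℕ, p.Prime → ∀ (k K : Type) [Field k] [CharP k p] [Field K] [Algebra k K] (O : ValuationSubring K) (A₀ : Subalgebra k K) (h₀ : A₀.toSubring ≤ O.toSubring) (t : K), A₀.FG → t ^ p ∈ A₀ → IsFractionRing (Algebra.adjoin k (insert t (A₀ : Set K))) K → IsRegularLocalRing (Localization.AtPrime (Ideal.comap (Subring.inclusion h₀) (IsLocalRing.maximalIdeal O))) → ringKrullDim (Localization.AtPrime (Ideal.comap (Subring.inclusion h₀) (IsLocalRing.maximalIdeal O))) = 2 → (∃ π : K, π ≠ 0 ∧ O.valuation π < 1 ∧ ∀ z : K, z ≠ 0 → ∃ n : ℤ, O.valuation z = O.valuation π ^ n) → ∃ (A : Subalgebra k K) (h : A.toSubring ≤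 O.toSubring), A₀ ≤ A ∧ t ∈ A ∧ A.FG ∧ IsFractionRing A K ∧ IsRegularLocalRing (Localization.AtPrime (Ideal.comap (Subring.inclusion h) (IsLocalRing.maximalIdeal O))) := by
  intro p hp k K _ _ _ _ O A₀ h₀ t hfg htp hfr hreg hdim _
  exact luAlphaPTorsor_of_ringKrullDim_le_two p hp k K O A₀ h₀ t hfg htp hfr hreg hdim.le

/-- **Transcendence degree `≤ 2` (surfaces): the crux `LuAlphaPTorsor` holds UNCONDITIONALLY,
for every prime `p`, every ground field `k` of characteristic `p` (perfect or not) and every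
valuation** — local uniformization of `α_p`-torsors `t^p = a` over regular bases along all
valuations of function fields of transcendence degree `≤ 2`. The local ring of the base at the
centre has dimension `height 𝔭 ≤ dim A₀ = trdeg_k A₀ ≤ trdeg_k K ≤ 2`
(`IsLocalization.AtPrime.ringKrullDim_eq_height`, `exists_ringKrullDim_eq_and_trdeg_eq`,
`trdeg_le_of_injective`), and `luAlphaPTorsor_of_ringKrullDim_le_two` (Mon_ν(2),
Giraud 1983 along `ν`) applies. [cite: Giraud1983, Thm. 2.4] -/
theorem luAlphaPTorsor_of_trdeg_le_two : ∀ p : ℕ, p.Prime → ∀ (k K : Type) [Field k] [CharP k p] [Field K] [Algebra k K] (O : ValuationSubring K) (A₀ : Subalgebra k K) (h₀ : A₀.toSubring ≤ O.toSubring) (t : K), A₀.FG → t ^ p ∈ A₀ → IsFractionRing (Algebra.adjoin k (insert t (A₀ : Set K))) K → IsRegularLocalRing (Localization.AtPrime (Ideal.comap (Subring.inclusion h₀) (IsLocalRing.maximalIdeal O))) → Algebra.trdeg k K ≤ 2 → ∃ (A : Subalgebra k K) (h : A.toSubring ≤ O.toSubring), A₀ ≤ A ∧ t ∈ A ∧ A.FG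 ∧ IsFractionRing A K ∧ IsRegularLocalRing (Localization.AtPrime (Ideal.comap (Subring.inclusion h) (IsLocalRing.maximalIdeal O))) := by
  intro p hp k K _ _ _ _ O A₀ h₀ t hfg htp hfr hreg hK
  refine luAlphaPTorsor_of_ringKrullDim_le_two p hp k K O A₀ h₀ t hfg htp hfr hreg ?_
  -- `dim (A₀)_𝔭 = height 𝔭 ≤ dim A₀ = trdeg_k A₀ ≤ trdeg_k K ≤ 2`
  haveI : Algebra.FiniteType k A₀ := A₀.fg_iff_finiteType.mp hfg
  obtain ⟨n, hn, htr⟩ := Literature.AlgebraicGeometry.Resolution.exists_ringKrullDim_eq_and_trdeg_eq k A₀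
  have hle : Algebra.trdeg k A₀ ≤ Algebra.trdeg k K :=
    trdeg_le_of_injective A₀.val Subtype.val_injective
  have hn2 : n ≤ 2 := by
    have h : (n : Cardinal) ≤ 2 := htr ▸ hle.trans hK
    exact_mod_cast h
  have hdimA : ringKrullDim A₀.toSubring ≤ 2 := by
    change ringKrullDim A₀ ≤ 2
    rw [hn]
    exact_mod_cast hn2
  rw [IsLocalization.AtPrime.ringKrullDim_eq_height
    (Ideal.comap (Subring.inclusion h₀) (IsLocalRing.maximalIdeal O))]
  exact (Ideal.height_le_ringKrullDim_of_ne_top (Ideal.IsPrime.ne_top inferInstance)).trans hdimA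

end Summit.ResolutionOfSingularities.ResolutionOfSingularities.Theorems.PfaffLine
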